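import Literature.NumberTheory.EllipticCurves.RankinSelbergBaseChangeBadPrimesProofs
import Literature.NumberTheory.EllipticCurves.RankinSelbergEulerProductHeckeRegroupProofs
import Literature.NumberTheory.GaloisRepresentations.HeckeCharacterInfinityTypeBaseChangeProofs
import Literature.NumberTheory.GaloisRepresentations.CMTypeHeckeCharacter
import HarnessLib

/-!
# `ω ∘ N_{E/F}` on the ideles of `F`, and the Hecke character `χ₀ · (ψ_θ ∘ N_{K/ℚ})` against the
# binders of a Rankin–Selberg line fact (finite order, trivial on `Ẑ^{(p),×}`, unramified at given primes)

Topic `NumberTheory/GaloisRepresentations`; PROOFS file (theorems only: no definition, no named fact,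
no instance — D-0026 net debt 0). Companion of `GlobalArtinMapNormProofs.lean` (`HeckeCharacter.compRelNorm`,
`ω ∘ N_{E/F}`), `RankinSelbergBaseChangeBadPrimesProofs.lean` (ramification of `ψ_θ ∘ N_{K/ℚ}`) and
`HeckeCharacterProofs.lean` (`HeckeCharacter.ofDirichlet`).

* §1 `HeckeCharacter.compRelNorm_ideleBaseChange` — **`(ω ∘ N_{E/F})(x_E) = ω(x)^{[E:F]}`** on the ideles of
  `F` (Cassels–Fröhlich VII §2: `N_{E/F}(x_E) = x^{[E:F]}`; tree `AdeleRing.ideleRelNorm_ideleBaseChange`).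
  (That `compRelNorm` is a homomorphism in `ω` preserving finite order is already in the tree:
  `HeckeCharacter.compRelNorm_mul/_one/_inv` in `HeckeCharacterInfinityTypeBaseChangeProofs.lean`,
  `HeckeCharacter.compRelNorm_pow` in `GlobalReciprocityCyclicDescentProofs.lean`,
  `EllipticCurves.HeckeCharacter.IsFiniteOrder.compRelNorm` in `RankinSelbergEulerProductHeckeRegroupProofs.lean`.)
* §2 For `K` QUADRATIC (Galois) and `θ` a QUADRATIC Dirichlet character (`θ² = 1`): **`ψ_θ ∘ N_{K/ℚ}` is
  trivial on the ideles of `ℚ`** (`compRelNorm_ofDirichlet_ideleBaseChange_eq_one`: `ψ_θ(x)² = ψ_{θ²}(x) = 1`)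
  — the genus-type character `θ ∘ N` "restricts to the trivial character of `𝔸_ℚ^×`".
* §3 The character `χ = χ₀ · (ψ_θ ∘ N_{K/ℚ})` of `K` against the three `χ`-binders of a cyclotomic-line
  Rankin–Selberg fact in the tree's shape (`Disegni2017.thmA_chiLine`, Disegni 2017 §1.2.1: `χ ∈ 𝒴′^{l.c.}`
  iff `ω·χ|_{Ô_F^{p,×}} = 1`): (a) `χ` has finite order if `χ₀` has (`isFiniteOrder_mul_compRelNorm_ofDirichlet`);
  (b) `χ` and `χ₀` AGREE on the base change of every idele of `ℚ` (`mul_compRelNorm_ofDirichlet_ideleBaseChange`),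
  so «`χ` trivial on the unit ideles of `ℚ` away from `p`» holds for `χ` iff for `χ₀`
  (`mul_compRelNorm_ofDirichlet_trivialOnRationalUnits_iff`); (c) `χ` is unramified at a place `w ∣ ℓ`
  with `ℓ ∤ cond θ` iff `χ₀` is (`mul_compRelNorm_ofDirichlet_isUnramifiedAt_iff`), whence the binder
  «unramified above every `ℓ` with `ℓ² ∣ N`» for `χ` follows from the same for `χ₀` when `cond θ` is prime
  to those `ℓ` (`mul_compRelNorm_ofDirichlet_unramified_binder`).

Motivation (BSD cell `bsd-print-cf2`, road (C) on crux `PrintCf2.SplitBadTwoRankOneOfFacts`): the pair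
character is `χ₀ · χ₂ · (ε_{d′} ∘ N)` with `χ₂ = ε_{d*} ∘ N_{K/ℚ}`, `K = ℚ(√−7)`, `ε_{d*}, ε_{d′}` quadratic;
after moving `ε_{d′}∘N` into the form (`σ_{A,K} ⊗ (ε∘N·χ′) = σ_{A⊗ε,K} ⊗ χ′`) the character fed to
`thmA_chiLine` is `χ₀ · (ψ_{ε_{d*}} ∘ N)`, and §3 reduces its three binders BY NAME to the corresponding
properties of `χ₀` (the skeleton's hypotheses on the anticyclotomic part). Nothing about BSD is proved here.

## References

* J. W. S. Cassels, A. Fröhlich (eds.), *Algebraic Number Theory* (1967), Ch. VII §2 (norm of a base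
  change `= x^{[E:F]}`), Prop. 4.3 (`ψ ∘ N`). [CasselsFrohlichANT1967]
* J. Neukirch, *Algebraic Number Theory* (1999), Ch. VII §6 Prop. (6.9) (conductor of `ψ_θ`). [NeukirchANT1999]
* D. Disegni, Compos. Math. 153 (2017), §1.2.1 (`𝒴′`, the condition `ω·χ|_{Ô^{p,×}} = 1`) and Theorem A
  (arXiv:1510.02114 pp. 5–7). [Disegni2017]
-/

noncomputable section

open scoped NumberField
open NumberField IsDedekindDomain IsDedekindDomain.HeightOneSpectrum Rat.HeightOneSpectrum
  Literature.NumberTheory.Automorphic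

namespace Literature.NumberTheory.GaloisRepresentations

namespace HeckeCharacter

/-! ### §1 `ω ∘ N_{E/F}` on the ideles of `F` -/

section General

variable {F : Type} {E : Type} [Field F] [Field E] [Algebra F E] [NumberField F] [NumberField E]
  [IsGalois F E]

/-- **`(ω ∘ N_{E/F})(x_E) = ω(x)^{[E:F]}`** for an idele `x` of `F` viewed in `𝔸_Eˣ`
(`N_{E/F}(x_E) = x^{[E:F]}`, `[E:F] = #Gal(E/F)`). [cite: CasselsFrohlichANT1967, Ch. VII §2] -/
theorem compRelNorm_ideleBaseChange (ω : HeckeCharacter F) (x : ideleGroup F) :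
    ω.compRelNorm E (AdeleRing.ideleBaseChange F E x) = ω x ^ Fintype.card (E ≃ₐ[F] E) := by
  rw [compRelNorm_apply, AdeleRing.ideleRelNorm_ideleBaseChange, map_pow]

end General

/-! ### §2 A quadratic Dirichlet character base-changed to a quadratic field is trivial on `𝔸_ℚˣ` -/

section Quadratic

variable (K : Type) [Field K] [NumberField K] [IsGalois ℚ K] {m : ℕ} [NeZero m]

/-- `ψ_θ(x)² = 1` for a quadratic Dirichlet character `θ` (`θ² = 1`): `ψ_θ(x) = θ(u(x) mod m)⁻¹` and
`θ(a)² = (θ²)(a) = 1` on units. [cite: NeukirchANT1999, Ch. VII §6 Prop. (6.9)] -/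
theorem ofDirichlet_apply_sq {θ : DirichletCharacter ℂ m} (hθ : θ ^ 2 = 1) (x : ideleGroup ℚ) :
    HeckeCharacter.ofDirichlet θ x ^ 2 = 1 := by
  rw [HeckeCharacter.ofDirichlet_apply, inv_pow, inv_eq_one]
  refine Units.ext ?_
  rw [Units.val_pow_eq_pow_val, MulChar.coe_toUnitHom, ← MulChar.pow_apply_coe, hθ,
    MulChar.one_apply_coe, Units.val_one]

/-- `ψ_θ² = 1` for `θ² = 1`. [cite: NeukirchANT1999, Ch. VII §6 Prop. (6.9)] -/
theorem ofDirichlet_sq {θ : DirichletCharacter ℂ m} (hθ : θ ^ 2 = 1) :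
    HeckeCharacter.ofDirichlet θ ^ 2 = 1 :=
  HeckeCharacter.ext fun x => by rw [pow_apply, ofDirichlet_apply_sq hθ, one_apply]

/-- **`(ψ_θ ∘ N_{K/ℚ})(x_K) = 1` for every idele `x` of `ℚ`**, when `K/ℚ` is quadratic (Galois) and
`θ` is quadratic: `(ψ_θ ∘ N)(x_K) = ψ_θ(x)^{[K:ℚ]} = ψ_θ(x)² = 1`. In the language of Disegni §1.2.1 the
genus-type character `θ ∘ N` satisfies `χ|_{𝔸_ℚ^×} = 1` (so `ω·χ|_{Ô^{p,×}} = 1` for `ω = 𝟙`).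
[cite: CasselsFrohlichANT1967, Ch. VII §2] [cite: Disegni2017, §1.2.1 (arXiv v3 PDF p. 5 L22–57)] -/
theorem compRelNorm_ofDirichlet_ideleBaseChange_eq_one (h2 : Module.finrank ℚ K = 2)
    {θ : DirichletCharacter ℂ m} (hθ : θ ^ 2 = 1) (x : ideleGroup ℚ) :
    (HeckeCharacter.ofDirichlet θ).compRelNorm K (AdeleRing.ideleBaseChange ℚ K x) = 1 := by
  have hcard : Fintype.card (K ≃ₐ[ℚ] K) = 2 := by
    rw [← Nat.card_eq_fintype_card, IsGalois.card_aut_eq_finrank, h2]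
  rw [compRelNorm_ideleBaseChange, hcard, ofDirichlet_apply_sq hθ]

end Quadratic

/-! ### §3 `χ₀ · (ψ_θ ∘ N_{K/ℚ})` against the binders of a cyclotomic-line Rankin–Selberg fact -/

section Pair

variable (K : Type) [Field K] [NumberField K] [IsGalois ℚ K] {m : ℕ} [NeZero m]

omit [NumberField K] [IsGalois ℚ K] in
/-- A prime of `𝓞 K` containing the rational prime `ℓ` lies over `ℓℤ` (private plumbing).
[cite: NeukirchANT1999, Ch. I §8 (8.1)] -/
private theorem mem_primesOver_span_of_natCast_mem' {ℓ : ℕ} (hℓ : ℓ.Prime)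
    {w : HeightOneSpectrum (𝓞 K)} (hw : ((ℓ : ℕ) : 𝓞 K) ∈ w.asIdeal) :
    w.asIdeal ∈ (Ideal.span {(ℓ : ℤ)}).primesOver (𝓞 K) := by
  haveI : Fact ℓ.Prime := ⟨hℓ⟩
  refine ⟨w.isPrime, ?_⟩
  rw [Ideal.liesOver_iff]
  refine Ideal.IsMaximal.eq_of_le (Int.ideal_span_isMaximal_of_prime ℓ) Ideal.IsPrime.ne_top' ?_
  rw [Ideal.span_singleton_le_iff_mem, Ideal.under_def, Ideal.mem_comap, algebraMap_int_eq, map_natCast]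
  exact hw

/-- **(a) Finite order.** `χ₀ · (ψ_θ ∘ N_{K/ℚ})` has finite order when `χ₀` has (`ψ_θ` has finite order,
`isFiniteOrder_ofDirichlet`; base change and products preserve it).
[cite: NeukirchANT1999, Ch. VII §6 Prop. (6.9)] [cite: CasselsFrohlichANT1967, Ch. VII Prop. 4.3] -/
theorem isFiniteOrder_mul_compRelNorm_ofDirichlet (θ : DirichletCharacter ℂ m) {χ₀ : HeckeCharacter K}
    (hχ₀ : χ₀.IsFiniteOrder) :
    (χ₀ * (HeckeCharacter.ofDirichlet θ).compRelNorm K).IsFiniteOrder :=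
  IsOfFinOrder.mul hχ₀ (Literature.NumberTheory.EllipticCurves.HeckeCharacter.IsFiniteOrder.compRelNorm K
    (HeckeCharacter.isFiniteOrder_ofDirichlet θ))

/-- **(b) Values on the ideles of `ℚ`.** For `K` quadratic and `θ` quadratic, `χ₀ · (ψ_θ ∘ N_{K/ℚ})` and
`χ₀` agree on the base change of every idele of `ℚ`. [cite: CasselsFrohlichANT1967, Ch. VII §2]
[cite: Disegni2017, §1.2.1 (arXiv v3 PDF p. 5 L22–57)] -/
theorem mul_compRelNorm_ofDirichlet_ideleBaseChange (h2 : Module.finrank ℚ K = 2)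
    {θ : DirichletCharacter ℂ m} (hθ : θ ^ 2 = 1) (χ₀ : HeckeCharacter K) (x : ideleGroup ℚ) :
    (χ₀ * (HeckeCharacter.ofDirichlet θ).compRelNorm K) (AdeleRing.ideleBaseChange ℚ K x) =
      χ₀ (AdeleRing.ideleBaseChange ℚ K x) := by
  rw [mul_apply, compRelNorm_ofDirichlet_ideleBaseChange_eq_one K h2 hθ, mul_one]

/-- **(b′) The binder «`χ` trivial on the unit ideles of `ℚ` away from `p`»** (the tree's shape of
Disegni's `χ ∈ 𝒴′^{l.c.}`, `ω·χ|_{Ô_ℚ^{p,×}} = 1` for `ω = 𝟙`, as in `Disegni2017.thmA_chiLine`) holds for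
`χ₀ · (ψ_θ ∘ N_{K/ℚ})` iff it holds for `χ₀` (`K` quadratic, `θ` quadratic).
[cite: Disegni2017, §1.2.1 (arXiv v3 PDF p. 5 L22–57)] [cite: CasselsFrohlichANT1967, Ch. VII §2] -/
theorem mul_compRelNorm_ofDirichlet_trivialOnRationalUnits_iff (h2 : Module.finrank ℚ K = 2)
    {θ : DirichletCharacter ℂ m} (hθ : θ ^ 2 = 1) (χ₀ : HeckeCharacter K) (p : ℕ) :
    (∀ (v : HeightOneSpectrum (𝓞 ℚ)) (u : (v.adicCompletionIntegers ℚ)ˣ),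
        ((p : ℕ) : 𝓞 ℚ) ∉ v.asIdeal →
        (χ₀ * (HeckeCharacter.ofDirichlet θ).compRelNorm K) (AdeleRing.ideleBaseChange ℚ K
          (localUnits v (Units.map ((v.adicCompletionIntegers ℚ).subtype : _ →* _) u))) = 1) ↔
    (∀ (v : HeightOneSpectrum (𝓞 ℚ)) (u : (v.adicCompletionIntegers ℚ)ˣ),
        ((p : ℕ) : 𝓞 ℚ) ∉ v.asIdeal →
        χ₀ (AdeleRing.ideleBaseChange ℚ K
          (localUnits v (Units.map ((v.adicCompletionIntegers ℚ).subtype : _ →* _) u))) = 1) := by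
  simp only [mul_compRelNorm_ofDirichlet_ideleBaseChange K h2 hθ]

/-- **(c) Ramification away from `cond θ`.** At a place `w ∣ ℓ` with `ℓ` a prime NOT dividing `m`,
`χ₀ · (ψ_θ ∘ N_{K/ℚ})` is unramified iff `χ₀` is (`ψ_θ ∘ N` is unramified above `ℓ ∤ m`,
`compRelNorm_ofDirichlet_valueAtUniformizer`). [cite: NeukirchANT1999, Ch. VII §6 Prop. (6.9)] -/
theorem mul_compRelNorm_ofDirichlet_isUnramifiedAt_iff (θ : DirichletCharacter ℂ m) (χ₀ : HeckeCharacter K)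
    {ℓ : ℕ} (hℓ : ℓ.Prime) (hℓm : ¬ ℓ ∣ m) {w : HeightOneSpectrum (𝓞 K)}
    (hw : ((ℓ : ℕ) : 𝓞 K) ∈ w.asIdeal) :
    (χ₀ * (HeckeCharacter.ofDirichlet θ).compRelNorm K).IsUnramifiedAt w ↔ χ₀.IsUnramifiedAt w := by
  have hθw : ((HeckeCharacter.ofDirichlet θ).compRelNorm K).IsUnramifiedAt w :=
    (Literature.NumberTheory.EllipticCurves.compRelNorm_ofDirichlet_valueAtUniformizer K θ hℓ hℓm
      (mem_primesOver_span_of_natCast_mem' K hℓ hw)).1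
  constructor
  · intro h
    have h' := h.mul' hθw.inv'
    rwa [mul_assoc, mul_inv_cancel, mul_one] at h'
  · intro h
    exact h.mul' hθw

/-- **(c′) The binder «unramified above every prime `ℓ` with `ℓ² ∣ N`»** (the tree-currency binder
(S5) of `Disegni2017.thmA_chiLine`) holds for `χ₀ · (ψ_θ ∘ N_{K/ℚ})` as soon as it holds for `χ₀` and
`m` (the level of `θ`) is prime to every such `ℓ` — for the road-(C) pair: `m ∈ {4, 8}` and the form,
good at `2`, has `4 ∤ N`. [cite: NeukirchANT1999, Ch. VII §6 Prop. (6.9)]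
[cite: Disegni2017, Theorem A (arXiv v3 PDF p. 6 L31–59)] -/
theorem mul_compRelNorm_ofDirichlet_unramified_binder (θ : DirichletCharacter ℂ m) (χ₀ : HeckeCharacter K)
    (N : ℕ) (hmN : ∀ ℓ : ℕ, ℓ.Prime → ℓ ^ 2 ∣ N → ¬ ℓ ∣ m)
    (hχ₀ : ∀ (w : HeightOneSpectrum (𝓞 K)) (ℓ : ℕ), ℓ.Prime → ((ℓ : ℕ) : 𝓞 K) ∈ w.asIdeal →
      ℓ ^ 2 ∣ N → χ₀.IsUnramifiedAt w) :
    ∀ (w : HeightOneSpectrum (𝓞 K)) (ℓ : ℕ), ℓ.Prime → ((ℓ : ℕ) : 𝓞 K) ∈ w.asIdeal →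
      ℓ ^ 2 ∣ N → (χ₀ * (HeckeCharacter.ofDirichlet θ).compRelNorm K).IsUnramifiedAt w :=
  fun w ℓ hℓ hw hN =>
    (mul_compRelNorm_ofDirichlet_isUnramifiedAt_iff K θ χ₀ hℓ (hmN ℓ hℓ hN) hw).mpr (hχ₀ w ℓ hℓ hw hN)

end Pair

end HeckeCharacter

end Literature.NumberTheory.GaloisRepresentations

end
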